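import Mathlib.Analysis.Complex.Circle
import Mathlib.Analysis.SpecialFunctions.Complex.Circle
import Mathlib.Analysis.SpecialFunctions.Trigonometric.Basic
import Literature.NumberTheory.Sieve.MoebiusWalshCircuits
import Literature.NumberTheory.LFunctions.MoebiusWalshCircuits
import HarnessLib

/-!
# Möbius/Liouville–Walsh: bridges between the tree's two vocabularies (proved)

Topic `Literature/NumberTheory/Sieve`. Everything in this file is PROVED (theorems only); it is the
proofs companion of `MoebiusWalshCircuits.lean` (named facts `bourgain_moebius_walsh`,
`bourgain_liouville_walsh`, Bourgain 2013 Theorem 1 and its Liouville parenthesis).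

The same printed theorem was vendored twice, in two vocabularies:

* here (`Literature.NumberTheory.Sieve.bourgain_*_walsh`): sums over `x ∈ range (2 ^ n)` of
  `g x * walsh A (fun j => x.testBit j)` (`Literature.Probability.RandomGraphs.LowDegree.walsh`),
  eventually in `n` (`∀ᶠ n in atTop`); the Liouville form with the saving exponent left free
  (`∃ c > 0`, bound `2^{n - n^c}`, `≤`);
* in `Literature/NumberTheory/LFunctions/MoebiusWalshCircuits.lean`
  (`Literature.NumberTheory.LFunctions.bourgain_*_walsh_uniform`): the cube sum
  `walshSum g A = ∑_{x : Fin n → Bool} g (bitsToNat (List.ofFn x)) · ∏_{j ∈ A} (−1)^{x j}`,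
  `∃ n₀, ∀ n ≥ n₀`, exponent `1/10` and `<` for both `μ` and `λ`.

We prove that the two Walsh sums agree (`walshSum_eq_sum_range`: binary expansion is a bijection
`{0,1}^n ≃ {0, …, 2^n − 1}` matching `bitsToNat ∘ List.ofFn` with `Nat.testBit`), hence
`bourgain_moebius_walsh ↔ bourgain_moebius_walsh_uniform` and
`bourgain_liouville_walsh_uniform → bourgain_liouville_walsh` (take `c = 1/10`). The Liouville
fact of this topic is therefore a COROLLARY of the `LFunctions` one; neither is proved in the tree
(Bourgain's proof needs Green 2012 Prop. 1 for `λ` — the tree's unproved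
`Literature.NumberTheory.LFunctions.green_liouville_fourierWalsh` — for `|A| ≤ √n/H`, and the
Mauduit–Rivat type I/II analysis of Bourgain 2013 §§1–3 for `|A| > √n/H`).

## Bourgain 2013, §1: Fourier coefficients of Walsh functions (first bricks of the proof)

The second part of the file starts the formalisation of Bourgain's argument with the "digital"
estimates of his §1, which every later step (Lemmas 4–6, the type-I bound (3.2)–(3.3) and the
type-II analysis of §2) rests on:

* `MoebiusWalsh.sum_walsh_mul_fourierChar_eq_prod` — (1.0)/(1.2): the Walsh function and the
  additive character both factor over the binary digits, so
  `∑_{N<2^n} w_A(N) e(Nθ) = ∏_{j<n} (1 + ε_j e(2^j θ))`, `ε_j = ∓1` according as `j ∈ A` or not;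
* `MoebiusWalsh.norm_sum_walsh_mul_fourierChar` — (1.2):
  `|∑_{N<2^n} w_A(N) e(Nθ)| = 2^n ∏_{j∉A} |cos(π2^jθ)| ∏_{j∈A} |sin(π2^jθ)|`
  (`MoebiusWalsh.digitFactor`);
* `MoebiusWalsh.sum_two_digitFactor_le` — the two-digit step (1.6): summing the two finest digit
  factors over the four cosets of `2^{n-2}ℤ/2^nℤ` gives at most `√(2 + √2)` (Cauchy–Schwarz);
* `MoebiusWalsh.digitL1_le` — **Lemma 3, (1.4)**, in the explicit form
  `∑_{k<2^n} ∏_j digitFactor (u j) (2^j k/2^n) ≤ 2 · 2^{(9/20) n}` for every digit pattern `u`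
  (recursion `digitL1_succ_succ_le` and `√(2+√2) ≤ 2^{9/10}`), whence
* `MoebiusWalsh.sum_norm_sum_walsh_mul_fourierChar_le` — `∑_{k<2^n} |∑_{N<2^n} w_A(N) e(Nk/2^n)|
  ≤ 2^n · 2 · 2^{(9/20)n}`, i.e. `‖ŵ_A‖_{ℓ¹} ≤ 2^{1 + (1/2 − 1/20) n}` uniformly in `A`
  (Bourgain: `≲ 2^{(1/2 − c)λ}` for some `c > 0`).

## References

* J. Bourgain, *Möbius–Walsh correlation bounds and an estimate of Mauduit and Rivat*,
  J. Anal. Math. 119 (2013) 147–163, Theorem 1 (arXiv:1109.2784, (0.3)); §1, (1.0)–(1.6),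
  Lemmas 1–3. [Bourgain2013MoebiusWalsh]
* B. Green, *On (not) computing the Möbius function using bounded depth circuits*,
  Combin. Probab. Comput. 21 (2012) 942–951, Proposition 1 (arXiv:1103.4991). [Green2012]
-/

open Finset Filter
open scoped FourierTransform
open Literature.Computability.Complexity
open Literature.Probability.RandomGraphs.LowDegree

namespace Literature.NumberTheory.Sieve

namespace MoebiusWalsh

/-! ### Binary digits: `bitsToNat ∘ List.ofFn` versus `Nat.testBit` -/

/-- The binary digits of the number with digit vector `x : Fin n → Bool` (least significant
first, `bitsToNat ∘ List.ofFn`): digit `i` is `x i` for `i < n` and `0` beyond. (Stated for digit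
vectors; the list form `(bitsToNat l).testBit i = l.getD i false` has several twins in
`Literature/Computability`, none importable here without the stack-machine layer.) [folklore] -/
theorem testBit_bitsToNat_ofFn_eq : ∀ {n : ℕ} (x : Fin n → Bool) (i : ℕ),
    (bitsToNat (List.ofFn x)).testBit i = if h : i < n then x ⟨i, h⟩ else false
  | 0, x, i => by simp
  | n + 1, x, 0 => by
      rw [List.ofFn_succ, bitsToNat_cons, dif_pos (Nat.succ_pos n)]
      have key : ∀ (b : Bool) (m : ℕ), (b.toNat + 2 * m).testBit 0 = b := fun b m => by
        cases b <;> simp [Nat.testBit_zero]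
      rw [key]
      rfl
  | n + 1, x, i + 1 => by
      rw [List.ofFn_succ, bitsToNat_cons, Nat.testBit_succ]
      have h2 : ((x 0).toNat + 2 * bitsToNat (List.ofFn fun j : Fin n => x j.succ)) / 2 =
          bitsToNat (List.ofFn fun j : Fin n => x j.succ) := by
        cases x 0 <;> simp [Nat.add_mul_div_left]
      rw [h2, testBit_bitsToNat_ofFn_eq (fun j : Fin n => x j.succ) i]
      by_cases hi : i < n
      · rw [dif_pos hi, dif_pos (Nat.succ_lt_succ hi)]
        rfl
      · rw [dif_neg hi, dif_neg (fun h => hi (Nat.lt_of_succ_lt_succ h))]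

/-- The digits of the number with digit vector `x : Fin n → Bool` are `x`. [folklore] -/
theorem testBit_bitsToNat_ofFn {n : ℕ} (x : Fin n → Bool) (j : Fin n) :
    (bitsToNat (List.ofFn x)).testBit j = x j := by
  rw [testBit_bitsToNat_ofFn_eq, dif_pos j.isLt]

/-- Beyond position `n` the digits of `bitsToNat (List.ofFn x)`, `x : Fin n → Bool`, vanish.
[folklore] -/
theorem testBit_bitsToNat_ofFn_of_le {n : ℕ} (x : Fin n → Bool) {i : ℕ} (hi : n ≤ i) :
    (bitsToNat (List.ofFn x)).testBit i = false := by
  rw [testBit_bitsToNat_ofFn_eq, dif_neg (Nat.not_lt.mpr hi)]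

/-- `bitsToNat (List.ofFn x) < 2 ^ n` for `x : Fin n → Bool`. [folklore] -/
theorem bitsToNat_ofFn_lt {n : ℕ} (x : Fin n → Bool) : bitsToNat (List.ofFn x) < 2 ^ n := by
  simpa using bitsToNat_lt (List.ofFn x)

/-- Reading off the `n` low digits of `N < 2^n` and reassembling gives back `N`. [folklore] -/
theorem bitsToNat_ofFn_testBit {n N : ℕ} (hN : N < 2 ^ n) :
    bitsToNat (List.ofFn fun j : Fin n => N.testBit j) = N := by
  refine Nat.eq_of_testBit_eq fun i => ?_
  by_cases hi : i < n
  · exact testBit_bitsToNat_ofFn (fun j : Fin n => N.testBit j) ⟨i, hi⟩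
  · rw [testBit_bitsToNat_ofFn_of_le _ (Nat.not_lt.mp hi), Nat.testBit_eq_false_of_lt]
    exact hN.trans_le (Nat.pow_le_pow_right Nat.two_pos (Nat.not_lt.mp hi))

/-- Reassembling the digit vector of `bitsToNat (List.ofFn x)` gives back `x`. [folklore] -/
theorem ofFn_testBit_bitsToNat {n : ℕ} (x : Fin n → Bool) :
    (fun j : Fin n => (bitsToNat (List.ofFn x)).testBit j) = x :=
  funext fun j => testBit_bitsToNat_ofFn x j

/-! ### The two Walsh sums agree -/

/-- The cube-indexed Walsh sum of `LFunctions/MoebiusWalshCircuits` equals the `range (2^n)`-indexed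
Walsh sum of this topic: `∑_{x ∈ {0,1}^n} g(val x) ∏_{j∈A} (−1)^{x_j} = ∑_{N < 2^n} g(N) w_A(bits N)`.
[folklore] -/
theorem walshSum_eq_sum_range {n : ℕ} (g : ℕ → ℤ) (A : Finset (Fin n)) :
    Literature.NumberTheory.LFunctions.walshSum g A =
      ∑ N ∈ range (2 ^ n), (g N : ℝ) * walsh A (fun j : Fin n => N.testBit j) := by
  unfold Literature.NumberTheory.LFunctions.walshSum
  refine Finset.sum_nbij' (fun x : Fin n → Bool => bitsToNat (List.ofFn x))
    (fun N : ℕ => fun j : Fin n => N.testBit j) ?_ ?_ ?_ ?_ ?_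
  · intro x _
    exact mem_range.mpr (bitsToNat_ofFn_lt x)
  · intro N _
    exact mem_univ _
  · intro x _
    exact ofFn_testBit_bitsToNat x
  · intro N hN
    exact bitsToNat_ofFn_testBit (mem_range.mp hN)
  · intro x _
    rw [ofFn_testBit_bitsToNat]
    simp only [walsh, sgn]

end MoebiusWalsh

open MoebiusWalsh

/-- **Dedup bridge (Möbius).** The two vendored forms of Bourgain 2013 Theorem 1 for `μ` are
equivalent: `bourgain_moebius_walsh` (this topic, `∀ᶠ n`, `range (2^n)`/`testBit`) `↔`
`Literature.NumberTheory.LFunctions.bourgain_moebius_walsh_uniform` (`∃ n₀`, cube sum `walshSum`).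
[cite: Bourgain2013MoebiusWalsh, Theorem 1] -/
theorem bourgain_moebius_walsh_iff_uniform :
    bourgain_moebius_walsh ↔ Literature.NumberTheory.LFunctions.bourgain_moebius_walsh_uniform := by
  unfold bourgain_moebius_walsh Literature.NumberTheory.LFunctions.bourgain_moebius_walsh_uniform
  rw [eventually_atTop]
  refine exists_congr fun n₀ => forall_congr' fun n => imp_congr_right fun _ =>
    forall_congr' fun A => ?_
  rw [walshSum_eq_sum_range]

/-- **Dedup bridge (Liouville).** The `LFunctions` form of Bourgain 2013 Theorem 1 for `λ`
(exponent `1/10`, strict inequality, cube sum) implies this topic's form with the exponent left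
free (`c = 1/10` works). The converse is not claimed (this topic's statement is the weaker,
exponent-free reading of "a similar estimate is also valid for the Liouville function").
[cite: Bourgain2013MoebiusWalsh, Theorem 1 (Liouville remark)] -/
theorem bourgain_liouville_walsh_of_uniform
    (h : Literature.NumberTheory.LFunctions.bourgain_liouville_walsh_uniform) :
    bourgain_liouville_walsh := by
  obtain ⟨n₀, hn₀⟩ := h
  refine ⟨1 / 10, by norm_num, eventually_atTop.mpr ⟨n₀, fun n hn A => ?_⟩⟩
  have := hn₀ n hn A
  rw [walshSum_eq_sum_range] at this
  exact this.le

/-! ## Bourgain 2013, §1: Fourier coefficients of Walsh functions -/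

namespace MoebiusWalsh

open Real Complex

/-! ### Digit factorisation of Walsh–Fourier sums (Bourgain (1.0)–(1.2)) -/

/-- Binary expansion: `bitsToNat (List.ofFn x) = ∑_j x_j 2^j` (a twin of
`Literature.Computability.Cryptography.ShorFP.bitsToNat_ofFn` in `ShorStepFP.lean`, kept private here
rather than importing the quantum-computing layer into this topic). [folklore] -/
private theorem bitsToNat_ofFn_eq_sum : ∀ {n : ℕ} (x : Fin n → Bool),
    bitsToNat (List.ofFn x) = ∑ j : Fin n, (x j).toNat * 2 ^ (j : ℕ)
  | 0, x => by simp
  | n + 1, x => by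
      rw [List.ofFn_succ, bitsToNat_cons, bitsToNat_ofFn_eq_sum (fun j : Fin n => x j.succ),
        Fin.sum_univ_succ]
      simp only [Fin.val_zero, pow_zero, mul_one, Fin.val_succ, pow_succ, Finset.mul_sum]
      congr 1
      exact Finset.sum_congr rfl fun j _ => by ring

/-- Reindexing a sum over `{0, …, 2^n − 1}` by digit vectors `x : Fin n → Bool`. [folklore] -/
theorem sum_range_two_pow_eq_sum_cube {M : Type*} [AddCommMonoid M] {n : ℕ} (F : ℕ → M) :
    ∑ N ∈ range (2 ^ n), F N = ∑ x : Fin n → Bool, F (bitsToNat (List.ofFn x)) := by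
  refine Finset.sum_nbij' (fun N : ℕ => fun j : Fin n => N.testBit j)
    (fun x : Fin n → Bool => bitsToNat (List.ofFn x)) ?_ ?_ ?_ ?_ ?_
  · intro N _; exact mem_univ _
  · intro x _; exact mem_range.mpr (bitsToNat_ofFn_lt x)
  · intro N hN; exact bitsToNat_ofFn_testBit (mem_range.mp hN)
  · intro x _; exact ofFn_testBit_bitsToNat x
  · intro N hN; rw [bitsToNat_ofFn_testBit (mem_range.mp hN)]

/-- `e` of a finite sum is the product of the `e`'s. [folklore] -/
theorem coe_fourierChar_sum {ι : Type*} (s : Finset ι) (a : ι → ℝ) :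
    ((𝐞 (∑ i ∈ s, a i) : Circle) : ℂ) = ∏ i ∈ s, ((𝐞 (a i) : Circle) : ℂ) := by
  classical
  induction s using Finset.induction_on with
  | empty => simp
  | insert i s hi ih => rw [sum_insert hi, prod_insert hi, AddChar.map_add_eq_mul, Circle.coe_mul, ih]

/-- **Walsh functions factor over the digits, and so does their Fourier transform**
(Bourgain 2013, (1.0) and the display before (1.2); Mauduit–Rivat): for `θ ∈ ℝ`,
`∑_{N < 2^n} w_A(N) e(Nθ) = ∏_{j < n} (1 + ε_j e(2^j θ))`, `ε_j = −1` if `j ∈ A`, `+1` otherwise.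
[cite: Bourgain2013MoebiusWalsh, §1 (1.0)–(1.2)] -/
theorem sum_walsh_mul_fourierChar_eq_prod (n : ℕ) (A : Finset (Fin n)) (θ : ℝ) :
    ∑ N ∈ range (2 ^ n), (walsh A (fun j : Fin n => N.testBit j) : ℂ) * (𝐞 ((N : ℝ) * θ) : ℂ) =
      ∏ j : Fin n, (1 + (if j ∈ A then (-1 : ℂ) else 1) * (𝐞 ((2 : ℝ) ^ (j : ℕ) * θ) : ℂ)) := by
  rw [sum_range_two_pow_eq_sum_cube]
  -- the summand at a digit vector `x` is a product over the digits
  set c : Fin n → Bool → ℂ := fun j b =>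
    (if j ∈ A then (sgn b : ℂ) else 1) * (𝐞 (((b.toNat : ℕ) : ℝ) * (2 : ℝ) ^ (j : ℕ) * θ) : ℂ) with hc
  have hsummand : ∀ x : Fin n → Bool,
      (walsh A (fun j : Fin n => (bitsToNat (List.ofFn x)).testBit j) : ℂ) *
          (𝐞 (((bitsToNat (List.ofFn x) : ℕ) : ℝ) * θ) : ℂ) = ∏ j : Fin n, c j (x j) := by
    intro x
    rw [ofFn_testBit_bitsToNat, bitsToNat_ofFn_eq_sum, hc]
    simp only
    rw [prod_mul_distrib]
    congr 1
    · rw [walsh, Complex.ofReal_prod, ← Finset.prod_filter]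
      simp
    · rw [← coe_fourierChar_sum]
      congr 2
      push_cast
      rw [Finset.sum_mul]
  rw [Finset.sum_congr rfl fun x _ => hsummand x, ← Fintype.piFinset_univ, ← Finset.prod_univ_sum]
  refine Finset.prod_congr rfl fun j _ => ?_
  rw [Fintype.sum_bool, hc]
  by_cases hj : j ∈ A <;> simp [hj] <;> ring

/-! ### Norms of the digit factors -/

/-- `‖1 + e(t)‖ = 2|cos(πt)|`. [folklore] -/
theorem norm_one_add_fourierChar (t : ℝ) : ‖(1 : ℂ) + (𝐞 t : ℂ)‖ = 2 * |Real.cos (π * t)| := by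
  rw [Real.fourierChar_apply, show ((2 * π * t : ℝ) : ℂ) = ((2 * (π * t) : ℝ) : ℂ) by ring_nf,
    Complex.exp_mul_I, ← Complex.ofReal_cos, ← Complex.ofReal_sin,
    show (1 : ℂ) + ((Real.cos (2 * (π * t)) : ℂ) + (Real.sin (2 * (π * t)) : ℂ) * I) =
      ((1 + Real.cos (2 * (π * t)) : ℝ) : ℂ) + (Real.sin (2 * (π * t)) : ℝ) * I by push_cast; ring,
    Complex.norm_add_mul_I, Real.cos_two_mul, Real.sin_two_mul]
  rw [show (1 + (2 * Real.cos (π * t) ^ 2 - 1)) ^ 2 + (2 * Real.sin (π * t) * Real.cos (π * t)) ^ 2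
      = (2 * Real.cos (π * t)) ^ 2 by nlinarith [Real.sin_sq_add_cos_sq (π * t)]]
  rw [Real.sqrt_sq_eq_abs, abs_mul, abs_two]

/-- `‖1 - e(t)‖ = 2|sin(πt)|`. [folklore] -/
theorem norm_one_sub_fourierChar (t : ℝ) : ‖(1 : ℂ) - (𝐞 t : ℂ)‖ = 2 * |Real.sin (π * t)| := by
  rw [Real.fourierChar_apply, show ((2 * π * t : ℝ) : ℂ) = ((2 * (π * t) : ℝ) : ℂ) by ring_nf,
    Complex.exp_mul_I, ← Complex.ofReal_cos, ← Complex.ofReal_sin,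
    show (1 : ℂ) - ((Real.cos (2 * (π * t)) : ℂ) + (Real.sin (2 * (π * t)) : ℂ) * I) =
      ((1 - Real.cos (2 * (π * t)) : ℝ) : ℂ) + (-Real.sin (2 * (π * t)) : ℝ) * I by push_cast; ring,
    Complex.norm_add_mul_I, Real.cos_two_mul, Real.sin_two_mul]
  rw [show (1 - (2 * Real.cos (π * t) ^ 2 - 1)) ^ 2 + (-(2 * Real.sin (π * t) * Real.cos (π * t))) ^ 2
      = (2 * Real.sin (π * t)) ^ 2 by nlinarith [Real.sin_sq_add_cos_sq (π * t)]]
  rw [Real.sqrt_sq_eq_abs, abs_mul, abs_two]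

/-- The digit factor `|cos(πs)|` (digit not in `A`) or `|sin(πs)|` (digit in `A`) of the modulus of a
Walsh–Fourier coefficient (Bourgain 2013, (1.2)). [cite: Bourgain2013MoebiusWalsh, (1.2)] -/
noncomputable def digitFactor (b : Bool) (s : ℝ) : ℝ := if b then |Real.sin (π * s)| else |Real.cos (π * s)|

/-- Digit factors are nonnegative. [folklore] -/
theorem digitFactor_nonneg (b : Bool) (s : ℝ) : 0 ≤ digitFactor b s := by
  unfold digitFactor; split_ifs <;> exact abs_nonneg _

/-- Digit factors are at most `1`. [folklore] -/
theorem digitFactor_le_one (b : Bool) (s : ℝ) : digitFactor b s ≤ 1 := by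
  unfold digitFactor; split_ifs
  · exact Real.abs_sin_le_one _
  · exact Real.abs_cos_le_one _

/-- **Bourgain 2013, (1.2)**: `|∑_{N<2^n} w_A(N) e(Nθ)| = 2^n ∏_{j∉A} |cos(π 2^j θ)| ∏_{j∈A} |sin(π 2^j θ)|`.
[cite: Bourgain2013MoebiusWalsh, (1.2)] -/
theorem norm_sum_walsh_mul_fourierChar (n : ℕ) (A : Finset (Fin n)) (θ : ℝ) :
    ‖∑ N ∈ range (2 ^ n), (walsh A (fun j : Fin n => N.testBit j) : ℂ) * (𝐞 ((N : ℝ) * θ) : ℂ)‖ =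
      2 ^ n * ∏ j : Fin n, digitFactor (decide (j ∈ A)) ((2 : ℝ) ^ (j : ℕ) * θ) := by
  rw [sum_walsh_mul_fourierChar_eq_prod, norm_prod]
  have h : ∀ j : Fin n, ‖(1 : ℂ) + (if j ∈ A then (-1 : ℂ) else 1) * (𝐞 ((2 : ℝ) ^ (j : ℕ) * θ) : ℂ)‖ =
      2 * digitFactor (decide (j ∈ A)) ((2 : ℝ) ^ (j : ℕ) * θ) := by
    intro j
    by_cases hj : j ∈ A
    · rw [if_pos hj, neg_one_mul, ← sub_eq_add_neg, norm_one_sub_fourierChar]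
      simp [digitFactor, hj]
    · rw [if_neg hj, one_mul, norm_one_add_fourierChar]
      simp [digitFactor, hj]
  simp_rw [h, prod_mul_distrib, prod_const, card_univ, Fintype.card_fin]

/-! ### Periodicity of the digit factors -/

/-- Digit factors are `1`-periodic. [folklore] -/
theorem digitFactor_add_nat (b : Bool) (s : ℝ) (m : ℕ) : digitFactor b (s + m) = digitFactor b s := by
  unfold digitFactor
  rw [show π * (s + m) = π * s + m * π by ring, Real.sin_add_nat_mul_pi, Real.cos_add_nat_mul_pi]
  simp [abs_mul]

/-- A half shift swaps `|cos|` and `|sin|`: `digitFactor b (s + 1/2) = digitFactor (¬b) s`. [folklore] -/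
theorem digitFactor_add_half (b : Bool) (s : ℝ) : digitFactor b (s + 1 / 2) = digitFactor (!b) s := by
  unfold digitFactor
  rw [show π * (s + 1 / 2) = π * s + π / 2 by ring, Real.sin_add_pi_div_two, Real.cos_add_pi_div_two]
  cases b <;> simp [abs_neg]

/-- `|sin x| + |cos x| ≤ √2`, in the form `(|sin x| + |cos x|)² = 1 + |sin 2x|`. [folklore] -/
theorem sq_abs_sin_add_abs_cos (x : ℝ) : (|Real.sin x| + |Real.cos x|) ^ 2 = 1 + |Real.sin (2 * x)| := by
  rw [Real.sin_two_mul, add_sq, sq_abs, sq_abs, show 2 * Real.sin x * Real.cos x = 2 * (Real.sin x * Real.cos x) by ring,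
    abs_mul, abs_mul, abs_two]
  nlinarith [Real.sin_sq_add_cos_sq x]

/-- The sum of the two digit factors of one digit is `|sin| + |cos|`, whatever the digit. [folklore] -/
theorem digitFactor_add_digitFactor_not (b : Bool) (s : ℝ) :
    digitFactor b s + digitFactor (!b) s = |Real.sin (π * s)| + |Real.cos (π * s)| := by
  cases b <;> simp [digitFactor, add_comm]

/-- `digitFactor b s ^ 2 + digitFactor (¬b) s ^ 2 = sin² + cos² = 1`. [folklore] -/
theorem digitFactor_sq_add_digitFactor_not_sq (b : Bool) (s : ℝ) :
    digitFactor b s ^ 2 + digitFactor (!b) s ^ 2 = 1 := by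
  cases b <;> simp [digitFactor, sq_abs, Real.sin_sq_add_cos_sq, Real.cos_sq_add_sin_sq]

/-- **The two-digit step of Bourgain's Lemma 3** (proof of (1.4), display (1.6)): summing the two
finest digit factors over the four cosets gives at most `√(2 + √2) < 2`.
[cite: Bourgain2013MoebiusWalsh, Lemma 3 (1.6)] -/
theorem sum_two_digitFactor_le (u₀ u₁ : Bool) (φ : ℝ) :
    ∑ m ∈ range 4, digitFactor u₀ (φ + m / 4) * digitFactor u₁ (2 * φ + m / 2) ≤
      Real.sqrt (2 + Real.sqrt 2) := by
  -- the four terms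
  have h1 : digitFactor u₁ (2 * φ + 1 / 2) = digitFactor (!u₁) (2 * φ) := digitFactor_add_half _ _
  have h2a : digitFactor u₀ (φ + 2 / 4) = digitFactor (!u₀) φ := by
    rw [show φ + 2 / 4 = φ + 1 / 2 by ring, digitFactor_add_half]
  have h2b : digitFactor u₁ (2 * φ + 2 / 2) = digitFactor u₁ (2 * φ) := by
    rw [show (2 : ℝ) * φ + 2 / 2 = 2 * φ + (1 : ℕ) by push_cast; ring, digitFactor_add_nat]
  have h3a : digitFactor u₀ (φ + 3 / 4) = digitFactor (!u₀) (φ + 1 / 4) := by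
    rw [show φ + 3 / 4 = φ + 1 / 4 + 1 / 2 by ring, digitFactor_add_half]
  have h3b : digitFactor u₁ (2 * φ + 3 / 2) = digitFactor (!u₁) (2 * φ) := by
    rw [show (2 : ℝ) * φ + 3 / 2 = 2 * φ + 1 / 2 + (1 : ℕ) by push_cast; ring, digitFactor_add_nat,
      digitFactor_add_half]
  simp only [Finset.sum_range_succ, Finset.sum_range_zero, zero_add, Nat.cast_zero, zero_div, add_zero,
    Nat.cast_one, Nat.cast_ofNat]
  rw [h1, h2a, h2b, h3a, h3b]
  -- Cauchy–Schwarz for two terms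
  set X := digitFactor u₁ (2 * φ)
  set Y := digitFactor (!u₁) (2 * φ)
  set a := digitFactor u₀ φ + digitFactor (!u₀) φ with ha
  set b := digitFactor u₀ (φ + 1 / 4) + digitFactor (!u₀) (φ + 1 / 4) with hb
  have hXY : X ^ 2 + Y ^ 2 = 1 := digitFactor_sq_add_digitFactor_not_sq _ _
  have ha2 : a ^ 2 = 1 + |Real.sin (2 * (π * φ))| := by
    rw [ha, digitFactor_add_digitFactor_not, sq_abs_sin_add_abs_cos]
  have hb2 : b ^ 2 = 1 + |Real.cos (2 * (π * φ))| := by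
    rw [hb, digitFactor_add_digitFactor_not, sq_abs_sin_add_abs_cos,
      show 2 * (π * (φ + 1 / 4)) = 2 * (π * φ) + π / 2 by ring, Real.sin_add_pi_div_two]
  have hsc : |Real.sin (2 * (π * φ))| + |Real.cos (2 * (π * φ))| ≤ Real.sqrt 2 := by
    have h0 : 0 ≤ |Real.sin (2 * (π * φ))| + |Real.cos (2 * (π * φ))| := by positivity
    rw [← Real.sqrt_sq h0]
    refine Real.sqrt_le_sqrt ?_
    rw [sq_abs_sin_add_abs_cos]
    have := Real.abs_sin_le_one (2 * (2 * (π * φ)))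
    linarith
  have hlhs : digitFactor u₀ φ * X + digitFactor u₀ (φ + 1 / 4) * Y + digitFactor (!u₀) φ * X +
      digitFactor (!u₀) (φ + 1 / 4) * Y = a * X + b * Y := by rw [ha, hb]; ring
  rw [hlhs]
  have hX : 0 ≤ X := digitFactor_nonneg _ _
  have hY : 0 ≤ Y := digitFactor_nonneg _ _
  have ha0 : 0 ≤ a := add_nonneg (digitFactor_nonneg _ _) (digitFactor_nonneg _ _)
  have hb0 : 0 ≤ b := add_nonneg (digitFactor_nonneg _ _) (digitFactor_nonneg _ _)
  have h0 : 0 ≤ a * X + b * Y := by positivity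
  rw [← Real.sqrt_sq h0]
  refine Real.sqrt_le_sqrt ?_
  calc (a * X + b * Y) ^ 2 ≤ (a ^ 2 + b ^ 2) * (X ^ 2 + Y ^ 2) := by nlinarith [sq_nonneg (a * Y - b * X)]
    _ = a ^ 2 + b ^ 2 := by rw [hXY, mul_one]
    _ ≤ 2 + Real.sqrt 2 := by rw [ha2, hb2]; linarith

/-! ### Bourgain's Lemma 3: `∑_k |ŵ_A(k)| ≲ 2^{(1/2 - c) n}` -/

/-- `S(n, u) = ∑_{k<2^n} ∏_{j<n} digitFactor (u j) (2^j k / 2^n)`: by (1.2), `∑_{k<2^n} |ŵ_A(k)|` for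
`u = 𝟙_A` (Bourgain 2013, (1.5)). [cite: Bourgain2013MoebiusWalsh, (1.5)] -/
noncomputable def digitL1 (n : ℕ) (u : Fin n → Bool) : ℝ :=
  ∑ k ∈ range (2 ^ n), ∏ j : Fin n, digitFactor (u j) ((2 : ℝ) ^ (j : ℕ) * ((k : ℝ) / 2 ^ n))

/-- `S(n, u) ≥ 0`. [folklore] -/
theorem digitL1_nonneg (n : ℕ) (u : Fin n → Bool) : 0 ≤ digitL1 n u :=
  sum_nonneg fun _ _ => prod_nonneg fun _ _ => digitFactor_nonneg _ _

/-- Splitting a sum over `range (a * c)` along residues mod `a`. [folklore] -/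
theorem sum_range_mul_eq_sum_sum {M : Type*} [AddCommMonoid M] (a c : ℕ) (f : ℕ → M) :
    ∑ k ∈ range (a * c), f k = ∑ i ∈ range a, ∑ m ∈ range c, f (i + a * m) := by
  rw [← sum_product' (range a) (range c) (fun i m => f (i + a * m))]
  refine sum_nbij' (fun k => (k % a, k / a)) (fun p => p.1 + a * p.2) ?_ ?_ ?_ ?_ ?_
  · intro k hk
    rw [mem_range] at hk
    have ha : 0 < a := Nat.pos_of_ne_zero (by rintro rfl; simp at hk)
    simp only [mem_product, mem_range]
    exact ⟨Nat.mod_lt _ ha, Nat.div_lt_of_lt_mul hk⟩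
  · rintro ⟨i, m⟩ hp
    simp only [mem_product, mem_range] at hp ⊢
    calc i + a * m < a + a * m := by omega
      _ = a * (m + 1) := by ring
      _ ≤ a * c := Nat.mul_le_mul_left a hp.2
  · intro k _
    exact Nat.mod_add_div k a
  · rintro ⟨i, m⟩ hp
    simp only [mem_product, mem_range] at hp
    have ha : 0 < a := by omega
    ext
    · simp [Nat.add_mul_mod_self_left, Nat.mod_eq_of_lt hp.1]
    · simp [Nat.add_mul_div_left _ _ ha, Nat.div_eq_of_lt hp.1]
  · intro k _
    simp only [Nat.mod_add_div]

/-- **The recursion of Bourgain's Lemma 3**: peeling off the two finest digits costs a factor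
`√(2 + √2)`. [cite: Bourgain2013MoebiusWalsh, Lemma 3 (proof)] -/
theorem digitL1_succ_succ_le (n : ℕ) (u : Fin (n + 2) → Bool) :
    digitL1 (n + 2) u ≤ Real.sqrt (2 + Real.sqrt 2) * digitL1 n (fun i => u i.succ.succ) := by
  unfold digitL1
  rw [show 2 ^ (n + 2) = 2 ^ n * 4 by ring, sum_range_mul_eq_sum_sum, Finset.mul_sum]
  refine sum_le_sum fun k _ => ?_
  set φ : ℝ := (k : ℝ) / 2 ^ (n + 2) with hφ
  set P : ℝ := ∏ i : Fin n, digitFactor (u i.succ.succ) ((2 : ℝ) ^ (i : ℕ) * ((k : ℝ) / 2 ^ n))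
    with hP
  have hterm : ∀ m ∈ range 4,
      ∏ j : Fin (n + 2), digitFactor (u j)
          ((2 : ℝ) ^ (j : ℕ) * (((k + 2 ^ n * m : ℕ) : ℝ) / 2 ^ (n + 2))) =
        digitFactor (u 0) (φ + m / 4) * digitFactor (u 1) (2 * φ + m / 2) * P := by
    intro m _
    rw [Fin.prod_univ_succ, Fin.prod_univ_succ, hP, ← mul_assoc]
    congr 1
    · congr 1
      · congr 1
        rw [hφ]
        push_cast
        simp only [Fin.val_zero, pow_zero, one_mul]
        field_simp
        ring
      · congr 1
        rw [hφ]
        push_cast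
        simp only [Fin.val_succ, Fin.val_zero]
        field_simp
        ring
    · refine prod_congr rfl fun i _ => ?_
      rw [show (2 : ℝ) ^ ((i.succ.succ : Fin (n + 2)) : ℕ) * (((k + 2 ^ n * m : ℕ) : ℝ) / 2 ^ (n + 2)) =
          (2 : ℝ) ^ (i : ℕ) * ((k : ℝ) / 2 ^ n) + ((2 ^ (i : ℕ) * m : ℕ) : ℝ) by
            push_cast
            simp only [Fin.val_succ, pow_succ]
            field_simp,
        digitFactor_add_nat]
  rw [sum_congr rfl hterm, ← sum_mul]
  have hP0 : 0 ≤ P := prod_nonneg fun i _ => digitFactor_nonneg _ _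
  exact mul_le_mul_of_nonneg_right (sum_two_digitFactor_le _ _ _) hP0

/-- The numerical inequality `√(2 + √2) ≤ 2^{9/10}` (indeed `(2 + √2)^5 = 232 + 164√2 < 512`).
[folklore] -/
theorem sqrt_two_add_sqrt_two_le : Real.sqrt (2 + Real.sqrt 2) ≤ (2 : ℝ) ^ (9 / 10 : ℝ) := by
  have hs : Real.sqrt 2 ≤ 71 / 50 := by
    rw [show (71 / 50 : ℝ) = Real.sqrt ((71 / 50) ^ 2) by rw [Real.sqrt_sq]; norm_num]
    exact Real.sqrt_le_sqrt (by norm_num)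
  have h0 : 0 ≤ 2 + Real.sqrt 2 := by positivity
  have h5 : (2 + Real.sqrt 2) ^ 5 ≤ (2 : ℝ) ^ 9 :=
    calc (2 + Real.sqrt 2) ^ 5 ≤ (2 + 71 / 50) ^ 5 := by gcongr
      _ ≤ 2 ^ 9 := by norm_num
  calc Real.sqrt (2 + Real.sqrt 2) = ((2 + Real.sqrt 2) ^ 5) ^ (1 / 10 : ℝ) := by
        rw [← Real.rpow_natCast_mul h0, Real.sqrt_eq_rpow]; norm_num
    _ ≤ ((2 : ℝ) ^ 9) ^ (1 / 10 : ℝ) := Real.rpow_le_rpow (by positivity) h5 (by norm_num)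
    _ = (2 : ℝ) ^ (9 / 10 : ℝ) := by rw [← Real.rpow_natCast_mul (by norm_num)]; norm_num

/-- **Bourgain 2013, Lemma 3** (explicit form): `S(n, u) ≤ 2 · 2^{(9/20) n}` for every digit pattern
`u`, i.e. `∑_{k<2^n} |ŵ_A(k)| ≤ 2 · 2^{(1/2 − 1/20) n}` uniformly in `A ⊆ {0,…,n−1}`.
[cite: Bourgain2013MoebiusWalsh, Lemma 3 (1.4)] -/
theorem digitL1_le : ∀ (n : ℕ) (u : Fin n → Bool), digitL1 n u ≤ 2 * (2 : ℝ) ^ ((9 / 20 : ℝ) * n) := by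
  intro n
  induction n using Nat.twoStepInduction with
  | zero =>
      intro u
      simp [digitL1]
  | one =>
      intro u
      have h1 : (1 : ℝ) ≤ (2 : ℝ) ^ ((9 / 20 : ℝ) * (1 : ℕ)) := Real.one_le_rpow (by norm_num) (by norm_num)
      calc digitL1 1 u ≤ ∑ k ∈ range (2 ^ 1), (1 : ℝ) :=
            sum_le_sum fun k _ => prod_le_one (fun _ _ => digitFactor_nonneg _ _)
              fun _ _ => digitFactor_le_one _ _
        _ = 2 := by simp
        _ ≤ 2 * (2 : ℝ) ^ ((9 / 20 : ℝ) * (1 : ℕ)) := by linarith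
  | more n ih _ =>
      intro u
      have hpow : (2 : ℝ) ^ ((9 / 20 : ℝ) * (n + 2 : ℕ)) = (2 : ℝ) ^ ((9 / 20 : ℝ) * n) * (2 : ℝ) ^ (9 / 10 : ℝ) := by
        rw [← Real.rpow_add (by norm_num : (0 : ℝ) < 2)]
        push_cast
        ring_nf
      have h2 : 0 ≤ (2 : ℝ) ^ ((9 / 20 : ℝ) * n) := by positivity
      calc digitL1 (n + 2) u ≤ Real.sqrt (2 + Real.sqrt 2) * digitL1 n (fun i => u i.succ.succ) :=
            digitL1_succ_succ_le n u
        _ ≤ Real.sqrt (2 + Real.sqrt 2) * (2 * (2 : ℝ) ^ ((9 / 20 : ℝ) * n)) :=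
            mul_le_mul_of_nonneg_left (ih _) (Real.sqrt_nonneg _)
        _ ≤ (2 : ℝ) ^ (9 / 10 : ℝ) * (2 * (2 : ℝ) ^ ((9 / 20 : ℝ) * n)) :=
            mul_le_mul_of_nonneg_right sqrt_two_add_sqrt_two_le (by positivity)
        _ = 2 * (2 : ℝ) ^ ((9 / 20 : ℝ) * (n + 2 : ℕ)) := by rw [hpow]; ring

/-- **Bourgain 2013, Lemma 3 (1.4)** for the Walsh system of this topic: uniformly in
`A ⊆ {0, …, n − 1}`, `∑_{k<2^n} |∑_{N<2^n} w_A(N) e(Nk/2^n)| ≤ 2^n · 2 · 2^{(9/20) n}`, i.e. the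
normalised Walsh–Fourier transform `ŵ_A(k) = 2^{-n} ∑_N w_A(N) e(Nk/2^n)` has
`‖ŵ_A‖_{ℓ¹(ℤ/2^nℤ)} ≤ 2^{1 + (1/2 − 1/20) n}` (printed: `≲ 2^{(1/2 − c)λ}` for some `c > 0`).
[cite: Bourgain2013MoebiusWalsh, Lemma 3 (1.4)] -/
theorem sum_norm_sum_walsh_mul_fourierChar_le (n : ℕ) (A : Finset (Fin n)) :
    ∑ k ∈ range (2 ^ n), ‖∑ N ∈ range (2 ^ n),
        (walsh A (fun j : Fin n => N.testBit j) : ℂ) * (𝐞 ((N : ℝ) * ((k : ℝ) / 2 ^ n)) : ℂ)‖ ≤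
      2 ^ n * (2 * (2 : ℝ) ^ ((9 / 20 : ℝ) * n)) := by
  simp_rw [norm_sum_walsh_mul_fourierChar]
  rw [← Finset.mul_sum]
  exact mul_le_mul_of_nonneg_left (digitL1_le n fun j => decide (j ∈ A)) (by positivity)

end MoebiusWalsh

end Literature.NumberTheory.Sieve
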